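import Summits.QuantumAdvantage.QuantumAdvantage.Theorems.LinnikCubicClassGroupsDegreeOnePrimesEscapeClassPNTSmoothed
import Literature.NumberTheory.LFunctions.WindowWeight
import HarnessLib

/-!
# Prime ideals of a class in short intervals, II: the smoothed class sums against a window weight
# through the explicit formulae of the whole family, two-sided, exceptional zeros kept

Topic `Summits/QuantumAdvantage/QuantumAdvantage/Theorems`, cell B2b-1 (linnik-cubic), PART A (gen 5);
helper for the crux `DegreeOnePrimesEscape` (stmt-QuantumAdvantage-11543) of route
`LinnikCubicClassGroups`.  HONEST FRAMING: the value of this file is a THEOREM (kernel-checked lemma)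
— NOT summit progress.

This is `…ClassPNTSmoothed.lean` with the Thorner–Zaman weight replaced by the WINDOW weight
`g = windowTest lo hi ε` (`0 < ε < lo < hi`; `Literature/…/WindowWeight.lean`), whose plateau is
`[lo, hi] = [log x, log(x+h)]`: for a number field `K`, a class `C`, the family `F_ψ` and the Laplace
transform `F` of `g`, orthogonality and the explicit formulae give, two-sidedly and with prescribed finite
sets `Exc ψ` of non-trivial zeros kept on the main-term side,

  `‖h_K ψ̃_C(g) − F(−1) + Σ_ψ ψ(C⁻¹) Σ_{ρ ∈ Exc ψ} m_ψ(ρ) F(−ρ)‖ ≤ Bf + h_K (M₀ + J)`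

(`norm_classNumber_mul_smoothedPsiClass_window_sub_le`), where `Bf` bounds the zero terms off the
exceptional segment (supplied by `fam_zeroSum_window_le_local` of file I), `M₀ ≥ m_ψ(0)(hi − lo + 2ε)`
the trivial-zero terms (`‖F(0)‖ ≤ hi − lo + 2ε`) and `J` the left-line integrals, for which
`norm_cgEFRemainder_windowTest_zero_le` / `norm_dzEFRemainder_windowTest_zero_le` give
`J ≤ leftLineConst · A(n+1) · (log|d_K| + log 4 + 1) · e^{−(lo−ε)/2} (2M/ε)` (`≍ x^{−1/2}/ε`).
The abstract two-sided reading `norm_explicit_core` and the supremum lemma of the template are reused.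
-/

noncomputable section

open Complex Real MeasureTheory Set Filter Topology
open scoped NumberField nonZeroDivisors

namespace Summit.QuantumAdvantage.QuantumAdvantage.Theorems.DegreeOnePrimesEscape

open Literature.NumberTheory.LFunctions Literature.NumberTheory.LFunctions.NumberField
  Literature.NumberTheory.LFunctions.EntireEF Literature.NumberTheory.LFunctions.WindowWeight
  Literature.NumberTheory.LFunctions.AbelianDensity

variable {K : Type} [Field K] [NumberField K]

/-! ### The left-line integrals against the window weight -/

/-- **`‖J_χ(0)‖ ≤ leftLineConst · A(n_K+1) · (log|d_K| + log 4 + 1) · e^{−(lo−ε)/2} (2M/ε)`** for `χ ≠ 1`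
and the window weight, with the constant `A` of `exists_norm_logDeriv_classGroupLFunction_left_le`. -/
theorem norm_cgEFRemainder_windowTest_zero_le {A : ℝ} (hA0 : 0 < A)
    (hA : ∀ (K : Type) [Field K] [NumberField K] (χ : ClassGroup (𝓞 K) →* ℂˣ) (t : ℝ),
      ‖logDeriv (classGroupLFunction K χ) (-1 / 2 + t * I)‖ ≤
        A * (Module.finrank ℚ K + 1) * (Real.log ((NumberField.discr K).natAbs : ℝ) + Real.log (|t| + 4)))
    {χ : ClassGroup (𝓞 K) →* ℂˣ} (hχ : χ ≠ 1) {M : ℝ}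
    (hM : ∀ y : ℝ, |iteratedDeriv 1 Real.smoothTransition y| ≤ M ∧ |iteratedDeriv 2 Real.smoothTransition y| ≤ M)
    {lo hi ε : ℝ} (hε : 0 < ε) (hεlo : ε < lo) (hlohi : lo < hi) :
    ‖cgEFRemainder χ (windowTest lo hi ε) 0‖ ≤
      leftLineConst * (A * (Module.finrank ℚ K + 1)) * (Real.log ((NumberField.discr K).natAbs : ℝ) + Real.log 4 + 1) *
        (Real.exp (-((lo - ε) / 2)) * (2 * M / ε)) := by
  have hM0 : 0 ≤ M := le_trans (abs_nonneg _) (hM 0).1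
  rw [cgEFRemainder]
  simp_rw [cgEFIntegrand]
  refine norm_leftLine_integral_le (by positivity) ?_ (by positivity) (fun y ↦ ?_)
    (fun y ↦ norm_fordLaplace_windowTest_leftLine_le hM hε hεlo hlohi y) ?_
  · have : 0 ≤ Real.log ((NumberField.discr K).natAbs : ℝ) := Real.log_natCast_nonneg _
    have : 0 ≤ Real.log 4 := Real.log_nonneg (by norm_num)
    linarith
  · rw [norm_neg, (classGroupLFunction₀_leftLine_ne_zero hχ y).2]
    refine (hA K χ y).trans ?_
    have hlog4 : Real.log (|y| + 4) ≤ Real.log 4 + Real.log (1 + |y|) := by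
      rw [← Real.log_mul (by norm_num) (by linarith [abs_nonneg y])]
      exact Real.log_le_log (by linarith [abs_nonneg y]) (by nlinarith [abs_nonneg y])
    have hl1 : 0 ≤ Real.log (1 + |y|) := Real.log_nonneg (by linarith [abs_nonneg y])
    refine mul_le_mul_of_nonneg_left ?_ (by positivity)
    linarith
  · have hcont := continuous_cgIntegrand_left hχ (windowTest_continuous lo hi ε) (by linarith : (0:ℝ) ≤ hi + ε)
      (fun u hu ↦ windowTest_eq_zero_of_ge hε hu) (windowTest_zero hε hεlo.le) 0
    simp_rw [cgEFIntegrand] at hcont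
    exact hcont.aestronglyMeasurable

/-- **`‖J₁(0)‖ ≤ leftLineConst · A(n_K+1) · (log|d_K| + log 4 + 1) · e^{−(lo−ε)/2} (2M/ε)`** for `ζ_K`
and the window weight. -/
theorem norm_dzEFRemainder_windowTest_zero_le {A : ℝ} (hA0 : 0 < A)
    (hA : ∀ (K : Type) [Field K] [NumberField K] (χ : ClassGroup (𝓞 K) →* ℂˣ) (t : ℝ),
      ‖logDeriv (classGroupLFunction K χ) (-1 / 2 + t * I)‖ ≤
        A * (Module.finrank ℚ K + 1) * (Real.log ((NumberField.discr K).natAbs : ℝ) + Real.log (|t| + 4)))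
    {M : ℝ} (hM : ∀ y : ℝ, |iteratedDeriv 1 Real.smoothTransition y| ≤ M ∧ |iteratedDeriv 2 Real.smoothTransition y| ≤ M)
    {lo hi ε : ℝ} (hε : 0 < ε) (hεlo : ε < lo) (hlohi : lo < hi) :
    ‖dzEFRemainder K (windowTest lo hi ε) 0‖ ≤
      leftLineConst * (A * (Module.finrank ℚ K + 1)) * (Real.log ((NumberField.discr K).natAbs : ℝ) + Real.log 4 + 1) *
        (Real.exp (-((lo - ε) / 2)) * (2 * M / ε)) := by
  have hM0 : 0 ≤ M := le_trans (abs_nonneg _) (hM 0).1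
  rw [dzEFRemainder]
  simp_rw [dzEFIntegrand]
  refine norm_leftLine_integral_le (by positivity) ?_ (by positivity) (fun y ↦ ?_)
    (fun y ↦ norm_fordLaplace_windowTest_leftLine_le hM hε hεlo hlohi y) ?_
  · have : 0 ≤ Real.log ((NumberField.discr K).natAbs : ℝ) := Real.log_natCast_nonneg _
    have : 0 ≤ Real.log 4 := Real.log_nonneg (by norm_num)
    linarith
  · rw [norm_neg, (classGroupLFunction_one_leftLine_ne_zero (K := K) y).2.2]
    refine (hA K 1 y).trans ?_
    have hlog4 : Real.log (|y| + 4) ≤ Real.log 4 + Real.log (1 + |y|) := by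
      rw [← Real.log_mul (by norm_num) (by linarith [abs_nonneg y])]
      exact Real.log_le_log (by linarith [abs_nonneg y]) (by nlinarith [abs_nonneg y])
    have hl1 : 0 ≤ Real.log (1 + |y|) := Real.log_nonneg (by linarith [abs_nonneg y])
    refine mul_le_mul_of_nonneg_left ?_ (by positivity)
    linarith
  · have hcont := continuous_dzIntegrand_left (K := K) (windowTest_continuous lo hi ε) (by linarith : (0:ℝ) ≤ hi + ε)
      (fun u hu ↦ windowTest_eq_zero_of_ge hε hu) (windowTest_zero hε hεlo.le) 0
    simp_rw [dzEFIntegrand] at hcont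
    exact hcont.aestronglyMeasurable

/-! ### The instance of the two-sided reading for the family `F_ψ` and the window weight -/

/-- **The explicit formula of `F_ψ` against the window weight, read two-sidedly, exceptional zeros kept.**
For `ψ ∈ Ĉl_K`, `0 < ε < lo < hi`, `g = windowTest lo hi ε`, a finite set `Exc` of non-trivial zeros of
`F_ψ`, a bound `B` for the finite partial sums of `m_ψ ‖F(−ρ)‖` over the non-trivial zeros outside `Exc`,
and bounds `M₀`, `J` for the trivial-zero term `m_ψ(0)(hi − lo + 2ε)` and the left-line integral:
`‖K_{χ_ψ}(g) − [ψ = 0] F(−1) + Σ_{ρ ∈ Exc} m_ψ(ρ) F(−ρ)‖ ≤ B + M₀ + J`. -/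
theorem norm_coefFordK_famF_window_sub_le (ψ : AddChar (Additive (ClassGroup (𝓞 K))) ℂ) {lo hi ε : ℝ}
    (hε : 0 < ε) (hεlo : ε < lo) (hlohi : lo < hi)
    (Exc : Finset ℂ) (hExc : ∀ ρ ∈ Exc, famF K ψ ρ = 0 ∧ 0 < ρ.re ∧ ρ.re < 1)
    {B M₀ J : ℝ}
    (hB : ∀ u : Finset ℂ, (∀ ρ ∈ u, famF K ψ ρ = 0 ∧ 0 < ρ.re ∧ ρ.re < 1) →
      ∑ ρ ∈ u with ρ ∉ Exc, (famMult K ψ ρ : ℝ) * ‖fordLaplace (windowTest lo hi ε) (-ρ)‖ ≤ B)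
    (hM₀ : (famMult K ψ 0 : ℝ) * (hi - lo + 2 * ε) ≤ M₀)
    (hJ0 : ψ = 0 → ‖dzEFRemainder K (windowTest lo hi ε) 0‖ ≤ J)
    (hJ : ψ ≠ 0 → ‖cgEFRemainder (toMulHom ψ).toHomUnits (windowTest lo hi ε) 0‖ ≤ J) :
    ‖coefFordK (cgCoef (toMulHom ψ).toHomUnits) (windowTest lo hi ε) 0 -
        (if ψ = 0 then fordLaplace (windowTest lo hi ε) (-1) else 0) +
        ∑ ρ ∈ Exc, (famMult K ψ ρ : ℂ) * fordLaplace (windowTest lo hi ε) (-ρ)‖ ≤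
      B + M₀ + J := by
  set g := windowTest lo hi ε with hg
  have hadm : IsSmoothedEFTest g g (deriv g) (deriv (deriv g)) (hi + ε) :=
    isSmoothedEFTest_windowTest hε hεlo.le hlohi.le
  have hg0 : g 0 = 0 := windowTest_zero hε hεlo.le
  have hF0 : ‖fordLaplace₀ g 0‖ ≤ hi - lo + 2 * ε := by
    rw [fordLaplace₀_eq_fordLaplace hg0]; exact norm_fordLaplace_windowTest_zero_le hε hεlo.le hlohi.le
  by_cases hψ : ψ = 0
  · -- `ψ = 0`: `F_0 = ζ₁_K`
    subst hψ
    simp only [if_true]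
    have hsz : ∀ ρ : ℂ, dedekindZeta₁ K ρ = 0 → 0 < ρ.re → ρ.re < 1 → ρ ≠ 0 := by
      intro ρ _ h1 _ h; rw [h] at h1; simp at h1
    have hexpl := coefFordK_one_eq_explicit (K := K) hadm hg0 (s := 0) (by norm_num) (by norm_num) hsz
    have hsum := summable_norm_dzZeroTerm (K := K) hadm (s := 0) (by norm_num) hsz
    have hExc' : ∀ ρ ∈ Exc, dedekindZeta₁ K ρ = 0 ∧ 0 < ρ.re ∧ ρ.re < 1 := by
      intro ρ hρ; have := hExc ρ hρ; rwa [famF_zero] at this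
    have hB' : ∀ u : Finset ℂ, (∀ ρ ∈ u, dedekindZeta₁ K ρ = 0 ∧ 0 < ρ.re ∧ ρ.re < 1) →
        ∑ ρ ∈ u with ρ ∉ Exc, (analyticOrderNatAt (dedekindZeta₁ K) ρ : ℝ) *
          ‖fordLaplace g (-ρ)‖ ≤ B := by
      intro u hu
      have := hB u (fun ρ hρ ↦ by rw [famF_zero]; exact hu ρ hρ)
      simpa only [famMult, famF_zero] using this
    have hmain : fordLaplace₀ g (0 - 1) = fordLaplace g (-1) := by
      rw [zero_sub, fordLaplace₀_eq_fordLaplace hg0]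
    rw [hmain] at hexpl
    have key := norm_explicit_core hg0 hsum hexpl hF0 Exc hExc' hB'
    have hm : (famMult K 0 0 : ℝ) = (analyticOrderNatAt (dedekindZeta₁ K) 0 : ℝ) := by
      rw [famMult, famF_zero]
    rw [hm] at hM₀
    have hJ' := hJ0 rfl
    have hcoef : coefFordK (cgCoef (toMulHom (0 : AddChar (Additive (ClassGroup (𝓞 K))) ℂ)).toHomUnits)
        g 0 = coefFordK (cgCoef (1 : ClassGroup (𝓞 K) →* ℂˣ)) g 0 := by
      rw [toHomUnits_toMulHom_zero]
    have hsumE : ∑ ρ ∈ Exc, (famMult K 0 ρ : ℂ) * fordLaplace g (-ρ) =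
        ∑ ρ ∈ Exc, (analyticOrderNatAt (dedekindZeta₁ K) ρ : ℂ) * fordLaplace g (-ρ) := by
      refine Finset.sum_congr rfl fun ρ _ ↦ ?_
      rw [famMult, famF_zero]
    rw [hcoef, hsumE]
    refine key.trans ?_
    have := mul_le_mul_of_nonneg_left hF0 (Nat.cast_nonneg (analyticOrderNatAt (dedekindZeta₁ K) 0))
    linarith
  · -- `ψ ≠ 0`: `F_ψ = L₀(·, χ_ψ)`
    simp only [hψ, if_false, sub_zero]
    set χ : ClassGroup (𝓞 K) →* ℂˣ := (toMulHom ψ).toHomUnits with hχdef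
    have hχ : χ ≠ 1 := toHomUnits_ne_one hψ
    have hsz : ∀ ρ : ℂ, classGroupLFunction₀ K χ ρ = 0 → 0 < ρ.re → ρ.re < 1 → ρ ≠ 0 := by
      intro ρ _ h1 _ h; rw [h] at h1; simp at h1
    have hexpl := coefFordK_eq_explicit hχ hadm hg0 (s := 0) (by norm_num) (by norm_num) hsz
    have hsum := summable_norm_cgZeroTerm hχ hadm (s := 0) (by norm_num) hsz
    have hExc' : ∀ ρ ∈ Exc, classGroupLFunction₀ K χ ρ = 0 ∧ 0 < ρ.re ∧ ρ.re < 1 := by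
      intro ρ hρ; have := hExc ρ hρ; rwa [famF_of_ne hψ] at this
    have hB' : ∀ u : Finset ℂ, (∀ ρ ∈ u, classGroupLFunction₀ K χ ρ = 0 ∧ 0 < ρ.re ∧ ρ.re < 1) →
        ∑ ρ ∈ u with ρ ∉ Exc, (analyticOrderNatAt (classGroupLFunction₀ K χ) ρ : ℝ) *
          ‖fordLaplace g (-ρ)‖ ≤ B := by
      intro u hu
      have := hB u (fun ρ hρ ↦ by rw [famF_of_ne hψ]; exact hu ρ hρ)
      simpa only [famMult, famF_of_ne hψ] using this
    have hexpl' : coefFordK (cgCoef χ) g 0 = 0 -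
        (∑' ρ : nontrivialZeros (classGroupLFunction₀ K χ),
          (analyticOrderNatAt (classGroupLFunction₀ K χ) (ρ : ℂ) : ℂ) * fordLaplace₀ g (0 - ρ)) -
        (analyticOrderNatAt (classGroupLFunction₀ K χ) 0 : ℂ) * fordLaplace₀ g 0 +
        cgEFRemainder χ g 0 := by
      rw [hexpl]; ring
    have key := norm_explicit_core hg0 hsum hexpl' hF0 Exc hExc' hB'
    have hm : (famMult K ψ 0 : ℝ) = (analyticOrderNatAt (classGroupLFunction₀ K χ) 0 : ℝ) := by
      rw [famMult, famF_of_ne hψ]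
    rw [hm] at hM₀
    have hJ' := hJ hψ
    have hsumE : ∑ ρ ∈ Exc, (famMult K ψ ρ : ℂ) * fordLaplace g (-ρ) =
        ∑ ρ ∈ Exc, (analyticOrderNatAt (classGroupLFunction₀ K χ) ρ : ℂ) * fordLaplace g (-ρ) := by
      refine Finset.sum_congr rfl fun ρ _ ↦ ?_
      rw [famMult, famF_of_ne hψ]
    rw [hsumE]
    rw [sub_zero] at key
    refine key.trans ?_
    have := mul_le_mul_of_nonneg_left hF0 (Nat.cast_nonneg (analyticOrderNatAt (classGroupLFunction₀ K χ) 0))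
    linarith

/-! ### The assembly over the family -/

set_option maxHeartbeats 800000 in
/-- **The smoothed class sum against the window weight through the family, two-sided, exceptional
zeros kept.**  For `0 < ε < lo < hi`, `g = windowTest lo hi ε`, a class `C`, finite sets `Exc ψ` of
non-trivial zeros of `F_ψ` containing all those in the exceptional segment `excRegion c K`, a FAMILY
bound `Bf` for the finite partial sums of the zero terms off the segment (the conclusion of
`fam_zeroSum_window_le_local`), and bounds `M₀`, `J` for the trivial-zero terms and the left-line
integrals of every member:
`‖h_K ψ̃_C(g) − F(−1) + Σ_ψ ψ(C⁻¹) Σ_{ρ ∈ Exc ψ} m_ψ(ρ) F(−ρ)‖ ≤ Bf + h_K (M₀ + J)`. -/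
theorem norm_classNumber_mul_smoothedPsiClass_window_sub_le {lo hi ε c : ℝ} (hε : 0 < ε)
    (hεlo : ε < lo) (hlohi : lo < hi) (C : ClassGroup (𝓞 K))
    (Exc : AddChar (Additive (ClassGroup (𝓞 K))) ℂ → Finset ℂ)
    (hExc : ∀ ψ, ∀ ρ ∈ Exc ψ, famF K ψ ρ = 0 ∧ 0 < ρ.re ∧ ρ.re < 1)
    (hExc' : ∀ ψ ρ, famF K ψ ρ = 0 → 0 < ρ.re → ρ.re < 1 → excRegion c K ρ → ρ ∈ Exc ψ)
    {Bf M₀ J : ℝ}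
    (hBf : ∀ u : AddChar (Additive (ClassGroup (𝓞 K))) ℂ → Finset ℂ,
        (∀ ψ, ∀ ρ ∈ u ψ, famF K ψ ρ = 0 ∧ 0 < ρ.re ∧ ρ.re < 1) →
        ∑ ψ, ∑ ρ ∈ u ψ with ¬ excRegion c K ρ,
            (famMult K ψ ρ : ℝ) * ‖fordLaplace (windowTest lo hi ε) (-ρ)‖ ≤ Bf)
    (hM₀ : ∀ ψ, (famMult K ψ 0 : ℝ) * (hi - lo + 2 * ε) ≤ M₀)
    (hJ0 : ‖dzEFRemainder K (windowTest lo hi ε) 0‖ ≤ J)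
    (hJ : ∀ ψ : AddChar (Additive (ClassGroup (𝓞 K))) ℂ, ψ ≠ 0 →
      ‖cgEFRemainder (toMulHom ψ).toHomUnits (windowTest lo hi ε) 0‖ ≤ J) :
    ‖(NumberField.classNumber K : ℂ) * (smoothedPsiClass K C (windowTest lo hi ε) : ℂ) -
        fordLaplace (windowTest lo hi ε) (-1) +
        ∑ ψ : AddChar (Additive (ClassGroup (𝓞 K))) ℂ, ψ (Additive.ofMul C⁻¹) *
          ∑ ρ ∈ Exc ψ, (famMult K ψ ρ : ℂ) * fordLaplace (windowTest lo hi ε) (-ρ)‖ ≤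
      Bf + (NumberField.classNumber K : ℝ) * (M₀ + J) := by
  classical
  set g := windowTest lo hi ε with hg
  have hg0' : ∀ u, hi + ε ≤ u → g u = 0 := fun u hu ↦ windowTest_eq_zero_of_ge hε hu
  -- the per-character suprema
  set P : AddChar (Additive (ClassGroup (𝓞 K))) ℂ → Finset ℂ → ℝ := fun ψ u ↦
    ∑ ρ ∈ u with ((famF K ψ ρ = 0 ∧ 0 < ρ.re ∧ ρ.re < 1) ∧ ρ ∉ Exc ψ),
      (famMult K ψ ρ : ℝ) * ‖fordLaplace g (-ρ)‖ with hP
  have hP0 : ∀ ψ u, 0 ≤ P ψ u := fun ψ u ↦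
    Finset.sum_nonneg fun ρ _ ↦ mul_nonneg (Nat.cast_nonneg _) (norm_nonneg _)
  have hPB : ∀ u : AddChar (Additive (ClassGroup (𝓞 K))) ℂ → Finset ℂ, ∑ ψ, P ψ (u ψ) ≤ Bf := by
    intro u
    have h := hBf (fun ψ ↦ (u ψ).filter (fun ρ ↦ famF K ψ ρ = 0 ∧ 0 < ρ.re ∧ ρ.re < 1))
      (fun ψ ρ hρ ↦ (Finset.mem_filter.1 hρ).2)
    refine le_trans (Finset.sum_le_sum fun ψ _ ↦ ?_) h
    rw [hP]; dsimp only
    rw [Finset.filter_filter]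
    refine Finset.sum_le_sum_of_subset_of_nonneg (fun ρ hρ ↦ ?_)
      fun ρ _ _ ↦ mul_nonneg (Nat.cast_nonneg _) (norm_nonneg _)
    rw [Finset.mem_filter] at hρ ⊢
    refine ⟨hρ.1, hρ.2.1, fun hexc ↦ hρ.2.2 (hExc' ψ ρ hρ.2.1.1 hρ.2.1.2.1 hρ.2.1.2.2 hexc)⟩
  have hsup := sum_ciSup_le_of_forall_sum_le P hP0 hPB
  have hbdd : ∀ ψ, BddAbove (Set.range (P ψ)) := by
    intro ψ
    refine ⟨Bf, ?_⟩
    rintro _ ⟨u, rfl⟩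
    have h := hPB (Function.update (fun _ ↦ (∅ : Finset ℂ)) ψ u)
    have hle : P ψ u ≤ ∑ φ, P φ (Function.update (fun _ ↦ (∅ : Finset ℂ)) ψ u φ) := by
      rw [← Finset.sum_erase_add _ _ (Finset.mem_univ ψ)]
      simp only [Function.update_self]
      have : 0 ≤ ∑ φ ∈ Finset.univ.erase ψ, P φ (Function.update (fun _ ↦ (∅ : Finset ℂ)) ψ u φ) :=
        Finset.sum_nonneg fun φ _ ↦ hP0 _ _
      linarith
    exact hle.trans h
  -- the per-character estimate with `B_ψ = ⨆_u P ψ u`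
  have hper : ∀ ψ : AddChar (Additive (ClassGroup (𝓞 K))) ℂ,
      ‖coefFordK (cgCoef (toMulHom ψ).toHomUnits) g 0 - (if ψ = 0 then fordLaplace g (-1) else 0) +
          ∑ ρ ∈ Exc ψ, (famMult K ψ ρ : ℂ) * fordLaplace g (-ρ)‖ ≤ (⨆ u, P ψ u) + M₀ + J := by
    intro ψ
    refine norm_coefFordK_famF_window_sub_le ψ hε hεlo hlohi (Exc ψ) (hExc ψ) (fun u hu ↦ ?_) (hM₀ ψ)
      (fun _ ↦ hJ0) (fun h0 ↦ hJ ψ h0)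
    refine le_trans (le_of_eq ?_) (le_ciSup (hbdd ψ) u)
    rw [hP]; dsimp only
    refine Finset.sum_congr (Finset.filter_congr fun ρ hρ ↦ ?_) fun _ _ ↦ rfl
    exact ⟨fun h ↦ ⟨hu ρ hρ, h⟩, fun h ↦ h.2⟩
  -- orthogonality
  have horth := classNumber_mul_smoothedPsiClass (K := K) C hg0'
  have hmain : ∑ ψ : AddChar (Additive (ClassGroup (𝓞 K))) ℂ,
      ψ (Additive.ofMul C⁻¹) * (if ψ = 0 then fordLaplace g (-1) else 0) = fordLaplace g (-1) := by
    rw [Finset.sum_eq_single (0 : AddChar (Additive (ClassGroup (𝓞 K))) ℂ)]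
    · rw [if_pos rfl, AddChar.zero_apply, one_mul]
    · intro ψ _ hψ; rw [if_neg hψ, mul_zero]
    · intro h; exact absurd (Finset.mem_univ _) h
  have hid : (NumberField.classNumber K : ℂ) * (smoothedPsiClass K C g : ℂ) - fordLaplace g (-1) +
      ∑ ψ : AddChar (Additive (ClassGroup (𝓞 K))) ℂ, ψ (Additive.ofMul C⁻¹) *
        ∑ ρ ∈ Exc ψ, (famMult K ψ ρ : ℂ) * fordLaplace g (-ρ) =
      ∑ ψ : AddChar (Additive (ClassGroup (𝓞 K))) ℂ, ψ (Additive.ofMul C⁻¹) *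
        (coefFordK (cgCoef (toMulHom ψ).toHomUnits) g 0 - (if ψ = 0 then fordLaplace g (-1) else 0) +
          ∑ ρ ∈ Exc ψ, (famMult K ψ ρ : ℂ) * fordLaplace g (-ρ)) := by
    rw [horth]
    simp only [mul_add, mul_sub, Finset.sum_add_distrib, Finset.sum_sub_distrib, hmain]
  rw [hid]
  calc ‖∑ ψ : AddChar (Additive (ClassGroup (𝓞 K))) ℂ, ψ (Additive.ofMul C⁻¹) *
        (coefFordK (cgCoef (toMulHom ψ).toHomUnits) g 0 - (if ψ = 0 then fordLaplace g (-1) else 0) +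
          ∑ ρ ∈ Exc ψ, (famMult K ψ ρ : ℂ) * fordLaplace g (-ρ))‖
      ≤ ∑ ψ : AddChar (Additive (ClassGroup (𝓞 K))) ℂ, ‖ψ (Additive.ofMul C⁻¹) *
        (coefFordK (cgCoef (toMulHom ψ).toHomUnits) g 0 - (if ψ = 0 then fordLaplace g (-1) else 0) +
          ∑ ρ ∈ Exc ψ, (famMult K ψ ρ : ℂ) * fordLaplace g (-ρ))‖ := norm_sum_le _ _
    _ ≤ ∑ ψ : AddChar (Additive (ClassGroup (𝓞 K))) ℂ, ((⨆ u, P ψ u) + M₀ + J) := by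
        refine Finset.sum_le_sum fun ψ _ ↦ ?_
        rw [norm_mul, norm_addChar_apply, one_mul]
        exact hper ψ
    _ = ∑ ψ : AddChar (Additive (ClassGroup (𝓞 K))) ℂ, (⨆ u, P ψ u) +
          (NumberField.classNumber K : ℝ) * (M₀ + J) := by
        rw [Finset.sum_add_distrib, Finset.sum_add_distrib, Finset.sum_const, Finset.sum_const,
          nsmul_eq_mul, nsmul_eq_mul, Finset.card_univ, card_addChar_classGroup]
        ring
    _ ≤ Bf + (NumberField.classNumber K : ℝ) * (M₀ + J) := add_le_add hsup le_rfl

end Summit.QuantumAdvantage.QuantumAdvantage.Theorems.DegreeOnePrimesEscape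

end
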